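import Literature.AlgebraicGeometry.Deformation.SmoothSchemeLiftObstructionConjugate
import Literature.AlgebraicGeometry.Deformation.SmoothSchemeLiftObstructionRefineCochain
import Literature.AlgebraicGeometry.Morphisms.CechModuleH2RefinementMap
import HarnessLib

/-!
# The obstruction CLASS does not depend on the cover: the obstruction cochains of one deformation datum on two principal
# affine covers agree, on a common refinement by basic opens, up to a Čech coboundary

Layer `Literature/AlgebraicGeometry/Deformation`, namespace `Literature.AlgebraicGeometry.Deformation`; THEOREMS ONLY
(no definition, no instance, no notation, no named fact, no `sorry`).  THE PRINT: [Hartshorne2010] Thm. 10.2 (a) and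
its proof (p. 81): «… we get an obstruction … One verifies that it is independent of the choices made»; the cover
independence is the passage to a common refinement ([GortzWedhorn2023] (21.16), Lemma 21.72).  ASSEMBLY, no new
mathematics: for lifted transition data `ψ` on `𝔘` with an obstruction cochain `o` (★ F2's characterisation
`SmoothSchemeLiftObstruction`) and `ψ₂` on `𝔘₂` with `o₂`, a common principal affine refinement `𝔚` by basic opens
of BOTH covers (`W s = D(a s) = D(a₂ s)`, ★ `Morphisms/PrincipalAffineCoverBasicOpenRefinement`), restricted lift
systems `ψ^W`, `ψ₂^W` (★ `SmoothSchemeLiftObstructionRefine.exists_algEquiv_refine`) and chart automorphisms `F s` of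
`A′ ⊗ Γ(W s)`, `≡ 1 (mod 𝔫′)`, intertwining `ψ^W`, `ψ₂^W` modulo `J` (the change of atlas — ★-to-be
`SmoothSchemeLiftChartIntertwiners`; here the HYPOTHESIS triple `F hF hFψ`, the shape of
★ `SmoothSchemeLiftObstructionConjugate.exists_cechMD1_eq_sub_of_conj` at the cover `𝔚`): the refined cochains `ρ_τ o`,
`ρ_{τ₂} o₂` are obstruction cochains of `ψ^W`, `ψ₂^W` (★ `SmoothSchemeLiftObstructionRefineCochain.
refineC2_obstructionCochain`), hence differ by a coboundary (★ `exists_cechMD1_eq_sub_of_conj`), hence have equal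
componentwise classes (★ `Morphisms/CechModuleH2RefinementMap`, ED. 2, § TwoCovers).

* `exists_cechMD1_eq_refineC2_sub_refineC2` — `∃ α, ρ_{τ₂} o₂ − ρ_τ o = d¹ α` in `Č²(𝔚, 𝒯_{X/k})`;
* `refineC2_sub_refineC2_mem_cechMB2` — the `B̌²` form;
* `CechMH2.mk_refineC2_mapC2_eq_of_two_covers` — for every `φ : 𝒯 ⟶ N`, `[ρ_{τ₂}(φ o₂)] = [ρ_τ(φ o)]` in `Ȟ²(𝔚, N)`:
  the relation rel₂ («cover independence») feeding the componentwise criterion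
  `Morphisms/CechModuleH2ScalingVanishing` (cell hodgecm-mathlib, F-11 α1 / J4-(iv) slot (4); B-p16 (g19), second hand
  under F0P1a-p04 (g2)).

HC_CM is proved only modulo the 7 printed citations until rung 0 closes — nothing here bears on a summit statement.

## References
* [Hartshorne2010] R. Hartshorne, *Deformation Theory*, GTM 257 (2010): Thm. 10.2 (a) and its proof (p. 81), Cor. 10.3 (p. 82).
* [GortzWedhorn2023] U. Görtz, T. Wedhorn, *Algebraic Geometry II: Cohomology of Schemes* (2023), (21.16), Lemma 21.72.
-/

noncomputable section

open CategoryTheory AlgebraicGeometry Opposite TopologicalSpace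
open scoped TensorProduct

universe u

namespace Literature.AlgebraicGeometry.Deformation

open Literature.AlgebraicGeometry.HodgeTheory Literature.AlgebraicGeometry.Modules
  Literature.AlgebraicGeometry.Motives Literature.AlgebraicGeometry.Morphisms SmoothAffineDeformation

variable {k : Type u} [Field k] {X : Over (Spec (CommRingCat.of k))}
  [instΓ : ∀ W : X.left.Opens, Algebra k Γ(X.left, W)]
  (halg : ∀ (W : X.left.Opens) (s : k), algebraMap k Γ(X.left, W) s = (constToPresheaf X).app (op W) s)
  {A' : Type u} [CommRing A'] [Algebra k A'] (J 𝔫' : Ideal A') (hJ : J * J = ⊥) (hJ𝔫 : J * 𝔫' = ⊥)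
  (e : ↥(J.restrictScalars k) ≃ₗ[k] k)
  -- two principal affine covers of the closed fibre
  {ι : Type u} (U : ι → X.left.affineOpens) (b : (j l : ι) → Γ(X.left, (U j).1))
  (hb : ∀ j l, (U j).1 ⊓ (U l).1 = X.left.basicOpen (b j l))
  {ι₂ : Type u} (U₂ : ι₂ → X.left.affineOpens) (b₂ : (j l : ι₂) → Γ(X.left, (U₂ j).1))
  (hb₂ : ∀ j l, (U₂ j).1 ⊓ (U₂ l).1 = X.left.basicOpen (b₂ j l))
  -- a common principal affine refinement by BASIC OPENS of both
  -- (★ `Morphisms.exists_finite_principal_affine_cover_basicOpen_refinement₂`)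
  {κ : Type u} (W : κ → X.left.affineOpens) (c : (s t : κ) → Γ(X.left, (W s).1))
  (hc : ∀ s t, (W s).1 ⊓ (W t).1 = X.left.basicOpen (c s t))
  (τ : κ → ι) (hτ : ∀ s, (W s).1 ≤ (U (τ s)).1) (a : (s : κ) → Γ(X.left, (U (τ s)).1))
  (hWa : ∀ s, (W s).1 = X.left.basicOpen (a s))
  (τ₂ : κ → ι₂) (hτ₂ : ∀ s, (W s).1 ≤ (U₂ (τ₂ s)).1) (a₂ : (s : κ) → Γ(X.left, (U₂ (τ₂ s)).1))
  (hWa₂ : ∀ s, (W s).1 = X.left.basicOpen (a₂ s))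

include halg hJ hJ𝔫 hb hb₂ hc hWa hWa₂ in
/-- **`ρ_{τ₂} o₂ − ρ_τ o = d¹ α`: obstruction cochains of one deformation datum on two covers agree on a common
refinement up to a coboundary** — given the change-of-atlas intertwiners `F s` on `𝔚` (hypotheses `F hF hFψ`, the
shape of ★ `exists_cechMD1_eq_sub_of_conj` at the cover `𝔚`); the refined cochains are obstruction cochains of the
restricted lifts (★ `refineC2_obstructionCochain`). [cite: Hartshorne2010, Thm. 10.2 (proof), p. 81]
[cite: GortzWedhorn2023, (21.16) Lemma 21.72] -/
theorem exists_cechMD1_eq_refineC2_sub_refineC2 (h𝔫 : IsNilpotent 𝔫')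
    -- cover 1: lifted transition automorphisms `ψ` and an obstruction cochain `o` of them (★ F2's characterisation)
    (ψ : (j l : ι) → A' ⊗[k] Γ(X.left, (U j).1 ⊓ (U l).1) ≃ₐ[A'] A' ⊗[k] Γ(X.left, (U j).1 ⊓ (U l).1))
    (hψ : ∀ j l x, ψ j l x - x ∈ 𝔫' • (⊤ : Submodule A' (A' ⊗[k] Γ(X.left, (U j).1 ⊓ (U l).1))))
    (o : CechMC2 X.hom (tangentSheaf X) (fun j => (U j).1))
    (ho : (∀ (j l m : ι)
      (Φjl : A' ⊗[k] Γ(X.left, (U j).1 ⊓ (U l).1) →ₐ[A'] A' ⊗[k] Γ(X.left, (U j).1 ⊓ (U l).1 ⊓ (U m).1))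
      (_ : ∀ a s, Φjl (a ⊗ₜ s) = a ⊗ₜ X.left.presheaf.map (homOfLE inf_le_left).op s)
      (Φlm : A' ⊗[k] Γ(X.left, (U l).1 ⊓ (U m).1) →ₐ[A'] A' ⊗[k] Γ(X.left, (U j).1 ⊓ (U l).1 ⊓ (U m).1))
      (_ : ∀ a s, Φlm (a ⊗ₜ s) = a ⊗ₜ X.left.presheaf.map
        (homOfLE (le_inf (inf_le_left.trans inf_le_right) inf_le_right)).op s)
      (Φjm : A' ⊗[k] Γ(X.left, (U j).1 ⊓ (U m).1) →ₐ[A'] A' ⊗[k] Γ(X.left, (U j).1 ⊓ (U l).1 ⊓ (U m).1))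
      (_ : ∀ a s, Φjm (a ⊗ₜ s) = a ⊗ₜ X.left.presheaf.map
        (homOfLE (le_inf (inf_le_left.trans inf_le_left) inf_le_right)).op s)
      (ρjl ρlm ρjm : A' ⊗[k] Γ(X.left, (U j).1 ⊓ (U l).1 ⊓ (U m).1) ≃ₐ[A']
        A' ⊗[k] Γ(X.left, (U j).1 ⊓ (U l).1 ⊓ (U m).1)),
      (∀ x, ρjl (Φjl x) = Φjl (ψ j l x)) → (∀ x, ρlm (Φlm x) = Φlm (ψ l m x)) →
      (∀ x, ρjm (Φjm x) = Φjm (ψ j m x)) →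
      ∀ c : Γ(X.left, (U j).1 ⊓ (U l).1 ⊓ (U m).1), (ρlm * ρjl * ρjm⁻¹) ((1 : A') ⊗ₜ c) =
        (1 : A') ⊗ₜ c + ((e.symm 1 : ↥(J.restrictScalars k)) : A') ⊗ₜ
          (show Γ(X.left, (U j).1 ⊓ (U l).1 ⊓ (U m).1) from appLE (o j l m) (𝟙 _) (dSection X _ c))))
    -- cover 2: likewise
    (ψ₂ : (j l : ι₂) → A' ⊗[k] Γ(X.left, (U₂ j).1 ⊓ (U₂ l).1) ≃ₐ[A'] A' ⊗[k] Γ(X.left, (U₂ j).1 ⊓ (U₂ l).1))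
    (hψ₂ : ∀ j l x, ψ₂ j l x - x ∈ 𝔫' • (⊤ : Submodule A' (A' ⊗[k] Γ(X.left, (U₂ j).1 ⊓ (U₂ l).1))))
    (o₂ : CechMC2 X.hom (tangentSheaf X) (fun j => (U₂ j).1))
    (ho₂ : (∀ (j l m : ι₂)
      (Φjl : A' ⊗[k] Γ(X.left, (U₂ j).1 ⊓ (U₂ l).1) →ₐ[A'] A' ⊗[k] Γ(X.left, (U₂ j).1 ⊓ (U₂ l).1 ⊓ (U₂ m).1))
      (_ : ∀ a s, Φjl (a ⊗ₜ s) = a ⊗ₜ X.left.presheaf.map (homOfLE inf_le_left).op s)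
      (Φlm : A' ⊗[k] Γ(X.left, (U₂ l).1 ⊓ (U₂ m).1) →ₐ[A'] A' ⊗[k] Γ(X.left, (U₂ j).1 ⊓ (U₂ l).1 ⊓ (U₂ m).1))
      (_ : ∀ a s, Φlm (a ⊗ₜ s) = a ⊗ₜ X.left.presheaf.map
        (homOfLE (le_inf (inf_le_left.trans inf_le_right) inf_le_right)).op s)
      (Φjm : A' ⊗[k] Γ(X.left, (U₂ j).1 ⊓ (U₂ m).1) →ₐ[A'] A' ⊗[k] Γ(X.left, (U₂ j).1 ⊓ (U₂ l).1 ⊓ (U₂ m).1))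
      (_ : ∀ a s, Φjm (a ⊗ₜ s) = a ⊗ₜ X.left.presheaf.map
        (homOfLE (le_inf (inf_le_left.trans inf_le_left) inf_le_right)).op s)
      (ρjl ρlm ρjm : A' ⊗[k] Γ(X.left, (U₂ j).1 ⊓ (U₂ l).1 ⊓ (U₂ m).1) ≃ₐ[A']
        A' ⊗[k] Γ(X.left, (U₂ j).1 ⊓ (U₂ l).1 ⊓ (U₂ m).1)),
      (∀ x, ρjl (Φjl x) = Φjl (ψ₂ j l x)) → (∀ x, ρlm (Φlm x) = Φlm (ψ₂ l m x)) →
      (∀ x, ρjm (Φjm x) = Φjm (ψ₂ j m x)) →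
      ∀ c : Γ(X.left, (U₂ j).1 ⊓ (U₂ l).1 ⊓ (U₂ m).1), (ρlm * ρjl * ρjm⁻¹) ((1 : A') ⊗ₜ c) =
        (1 : A') ⊗ₜ c + ((e.symm 1 : ↥(J.restrictScalars k)) : A') ⊗ₜ
          (show Γ(X.left, (U₂ j).1 ⊓ (U₂ l).1 ⊓ (U₂ m).1) from appLE (o₂ j l m) (𝟙 _) (dSection X _ c))))
    -- the restricted lift systems on the common refinement `𝔚` (★ `exists_algEquiv_refine` outputs, both clauses)
    (ψW : (s t : κ) → A' ⊗[k] Γ(X.left, (W s).1 ⊓ (W t).1) ≃ₐ[A'] A' ⊗[k] Γ(X.left, (W s).1 ⊓ (W t).1))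
    (hψW : (∀ (s t : κ) (Φ : A' ⊗[k] Γ(X.left, (U (τ s)).1 ⊓ (U (τ t)).1) →ₐ[A']
        A' ⊗[k] Γ(X.left, (W s).1 ⊓ (W t).1)),
      (∀ a' x, Φ (a' ⊗ₜ x) = a' ⊗ₜ X.left.presheaf.map (homOfLE (inf_le_inf (hτ s) (hτ t))).op x) →
      ∀ x, ψW s t (Φ x) = Φ (ψ (τ s) (τ t) x)))
    (hψW𝔫 : ∀ s t x, ψW s t x - x ∈ 𝔫' • (⊤ : Submodule A' (A' ⊗[k] Γ(X.left, (W s).1 ⊓ (W t).1))))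
    (ψ₂W : (s t : κ) → A' ⊗[k] Γ(X.left, (W s).1 ⊓ (W t).1) ≃ₐ[A'] A' ⊗[k] Γ(X.left, (W s).1 ⊓ (W t).1))
    (hψ₂W : (∀ (s t : κ) (Φ : A' ⊗[k] Γ(X.left, (U₂ (τ₂ s)).1 ⊓ (U₂ (τ₂ t)).1) →ₐ[A']
        A' ⊗[k] Γ(X.left, (W s).1 ⊓ (W t).1)),
      (∀ a' x, Φ (a' ⊗ₜ x) = a' ⊗ₜ X.left.presheaf.map (homOfLE (inf_le_inf (hτ₂ s) (hτ₂ t))).op x) →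
      ∀ x, ψ₂W s t (Φ x) = Φ (ψ₂ (τ₂ s) (τ₂ t) x)))
    (hψ₂W𝔫 : ∀ s t x, ψ₂W s t x - x ∈ 𝔫' • (⊤ : Submodule A' (A' ⊗[k] Γ(X.left, (W s).1 ⊓ (W t).1))))
    -- the change-of-atlas intertwiners on `𝔚` (★-to-be `SmoothSchemeLiftChartIntertwiners`; here hypotheses)
    (F : (s : κ) → A' ⊗[k] Γ(X.left, (W s).1) ≃ₐ[A'] A' ⊗[k] Γ(X.left, (W s).1))
    (hF : ∀ s x, F s x - x ∈ 𝔫' • (⊤ : Submodule A' (A' ⊗[k] Γ(X.left, (W s).1))))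
    (hFψ : (∀ (s t : κ)
      (Φs : A' ⊗[k] Γ(X.left, (W s).1) →ₐ[A'] A' ⊗[k] Γ(X.left, (W s).1 ⊓ (W t).1))
      (_ : ∀ a x, Φs (a ⊗ₜ x) = a ⊗ₜ X.left.presheaf.map (homOfLE inf_le_left).op x)
      (Φt : A' ⊗[k] Γ(X.left, (W t).1) →ₐ[A'] A' ⊗[k] Γ(X.left, (W s).1 ⊓ (W t).1))
      (_ : ∀ a x, Φt (a ⊗ₜ x) = a ⊗ₜ X.left.presheaf.map (homOfLE inf_le_right).op x)
      (Fs Ft : A' ⊗[k] Γ(X.left, (W s).1 ⊓ (W t).1) ≃ₐ[A'] A' ⊗[k] Γ(X.left, (W s).1 ⊓ (W t).1)),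
      (∀ x, Fs (Φs x) = Φs (F s x)) → (∀ x, Ft (Φt x) = Φt (F t x)) →
      ∀ c : Γ(X.left, (W s).1 ⊓ (W t).1),
        Ft (ψW s t ((1 : A') ⊗ₜ c)) - ψ₂W s t (Fs ((1 : A') ⊗ₜ c)) ∈
          J • (⊤ : Submodule A' (A' ⊗[k] Γ(X.left, (W s).1 ⊓ (W t).1))))) :
    ∃ α : CechMC1 X.hom (tangentSheaf X) (fun s => (W s).1),
      cechMRefineC2 X.hom (tangentSheaf X) (fun j => (U₂ j).1) (fun s => (W s).1) τ₂ hτ₂ o₂ -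
          cechMRefineC2 X.hom (tangentSheaf X) (fun j => (U j).1) (fun s => (W s).1) τ hτ o =
        cechMD1 X.hom (tangentSheaf X) (fun s => (W s).1) α :=
  exists_cechMD1_eq_sub_of_conj halg W c hc J 𝔫' hJ hJ𝔫 e h𝔫 ψW ψ₂W hψW𝔫 hψ₂W𝔫 F hF hFψ _ _
    (refineC2_obstructionCochain halg U b hb (fun s => (W s).1) τ hτ a hWa J 𝔫' hJ e h𝔫 ψ hψ o ho ψW hψW)
    (refineC2_obstructionCochain halg U₂ b₂ hb₂ (fun s => (W s).1) τ₂ hτ₂ a₂ hWa₂ J 𝔫' hJ e h𝔫 ψ₂ hψ₂ o₂ ho₂ ψ₂W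
      hψ₂W)

include halg hJ hJ𝔫 hb hb₂ hc hWa hWa₂ in
/-- `B̌²` form of `exists_cechMD1_eq_refineC2_sub_refineC2`: `ρ_{τ₂} o₂ − ρ_τ o ∈ B̌²(𝔚, 𝒯_{X/k})`.
[cite: Hartshorne2010, Thm. 10.2 (proof), p. 81] [cite: GortzWedhorn2023, (21.16) Lemma 21.72] -/
theorem refineC2_sub_refineC2_mem_cechMB2 (h𝔫 : IsNilpotent 𝔫')
    -- cover 1: lifted transition automorphisms `ψ` and an obstruction cochain `o` of them (★ F2's characterisation)
    (ψ : (j l : ι) → A' ⊗[k] Γ(X.left, (U j).1 ⊓ (U l).1) ≃ₐ[A'] A' ⊗[k] Γ(X.left, (U j).1 ⊓ (U l).1))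
    (hψ : ∀ j l x, ψ j l x - x ∈ 𝔫' • (⊤ : Submodule A' (A' ⊗[k] Γ(X.left, (U j).1 ⊓ (U l).1))))
    (o : CechMC2 X.hom (tangentSheaf X) (fun j => (U j).1))
    (ho : (∀ (j l m : ι)
      (Φjl : A' ⊗[k] Γ(X.left, (U j).1 ⊓ (U l).1) →ₐ[A'] A' ⊗[k] Γ(X.left, (U j).1 ⊓ (U l).1 ⊓ (U m).1))
      (_ : ∀ a s, Φjl (a ⊗ₜ s) = a ⊗ₜ X.left.presheaf.map (homOfLE inf_le_left).op s)
      (Φlm : A' ⊗[k] Γ(X.left, (U l).1 ⊓ (U m).1) →ₐ[A'] A' ⊗[k] Γ(X.left, (U j).1 ⊓ (U l).1 ⊓ (U m).1))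
      (_ : ∀ a s, Φlm (a ⊗ₜ s) = a ⊗ₜ X.left.presheaf.map
        (homOfLE (le_inf (inf_le_left.trans inf_le_right) inf_le_right)).op s)
      (Φjm : A' ⊗[k] Γ(X.left, (U j).1 ⊓ (U m).1) →ₐ[A'] A' ⊗[k] Γ(X.left, (U j).1 ⊓ (U l).1 ⊓ (U m).1))
      (_ : ∀ a s, Φjm (a ⊗ₜ s) = a ⊗ₜ X.left.presheaf.map
        (homOfLE (le_inf (inf_le_left.trans inf_le_left) inf_le_right)).op s)
      (ρjl ρlm ρjm : A' ⊗[k] Γ(X.left, (U j).1 ⊓ (U l).1 ⊓ (U m).1) ≃ₐ[A']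
        A' ⊗[k] Γ(X.left, (U j).1 ⊓ (U l).1 ⊓ (U m).1)),
      (∀ x, ρjl (Φjl x) = Φjl (ψ j l x)) → (∀ x, ρlm (Φlm x) = Φlm (ψ l m x)) →
      (∀ x, ρjm (Φjm x) = Φjm (ψ j m x)) →
      ∀ c : Γ(X.left, (U j).1 ⊓ (U l).1 ⊓ (U m).1), (ρlm * ρjl * ρjm⁻¹) ((1 : A') ⊗ₜ c) =
        (1 : A') ⊗ₜ c + ((e.symm 1 : ↥(J.restrictScalars k)) : A') ⊗ₜ
          (show Γ(X.left, (U j).1 ⊓ (U l).1 ⊓ (U m).1) from appLE (o j l m) (𝟙 _) (dSection X _ c))))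
    -- cover 2: likewise
    (ψ₂ : (j l : ι₂) → A' ⊗[k] Γ(X.left, (U₂ j).1 ⊓ (U₂ l).1) ≃ₐ[A'] A' ⊗[k] Γ(X.left, (U₂ j).1 ⊓ (U₂ l).1))
    (hψ₂ : ∀ j l x, ψ₂ j l x - x ∈ 𝔫' • (⊤ : Submodule A' (A' ⊗[k] Γ(X.left, (U₂ j).1 ⊓ (U₂ l).1))))
    (o₂ : CechMC2 X.hom (tangentSheaf X) (fun j => (U₂ j).1))
    (ho₂ : (∀ (j l m : ι₂)
      (Φjl : A' ⊗[k] Γ(X.left, (U₂ j).1 ⊓ (U₂ l).1) →ₐ[A'] A' ⊗[k] Γ(X.left, (U₂ j).1 ⊓ (U₂ l).1 ⊓ (U₂ m).1))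
      (_ : ∀ a s, Φjl (a ⊗ₜ s) = a ⊗ₜ X.left.presheaf.map (homOfLE inf_le_left).op s)
      (Φlm : A' ⊗[k] Γ(X.left, (U₂ l).1 ⊓ (U₂ m).1) →ₐ[A'] A' ⊗[k] Γ(X.left, (U₂ j).1 ⊓ (U₂ l).1 ⊓ (U₂ m).1))
      (_ : ∀ a s, Φlm (a ⊗ₜ s) = a ⊗ₜ X.left.presheaf.map
        (homOfLE (le_inf (inf_le_left.trans inf_le_right) inf_le_right)).op s)
      (Φjm : A' ⊗[k] Γ(X.left, (U₂ j).1 ⊓ (U₂ m).1) →ₐ[A'] A' ⊗[k] Γ(X.left, (U₂ j).1 ⊓ (U₂ l).1 ⊓ (U₂ m).1))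
      (_ : ∀ a s, Φjm (a ⊗ₜ s) = a ⊗ₜ X.left.presheaf.map
        (homOfLE (le_inf (inf_le_left.trans inf_le_left) inf_le_right)).op s)
      (ρjl ρlm ρjm : A' ⊗[k] Γ(X.left, (U₂ j).1 ⊓ (U₂ l).1 ⊓ (U₂ m).1) ≃ₐ[A']
        A' ⊗[k] Γ(X.left, (U₂ j).1 ⊓ (U₂ l).1 ⊓ (U₂ m).1)),
      (∀ x, ρjl (Φjl x) = Φjl (ψ₂ j l x)) → (∀ x, ρlm (Φlm x) = Φlm (ψ₂ l m x)) →
      (∀ x, ρjm (Φjm x) = Φjm (ψ₂ j m x)) →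
      ∀ c : Γ(X.left, (U₂ j).1 ⊓ (U₂ l).1 ⊓ (U₂ m).1), (ρlm * ρjl * ρjm⁻¹) ((1 : A') ⊗ₜ c) =
        (1 : A') ⊗ₜ c + ((e.symm 1 : ↥(J.restrictScalars k)) : A') ⊗ₜ
          (show Γ(X.left, (U₂ j).1 ⊓ (U₂ l).1 ⊓ (U₂ m).1) from appLE (o₂ j l m) (𝟙 _) (dSection X _ c))))
    -- the restricted lift systems on the common refinement `𝔚` (★ `exists_algEquiv_refine` outputs, both clauses)
    (ψW : (s t : κ) → A' ⊗[k] Γ(X.left, (W s).1 ⊓ (W t).1) ≃ₐ[A'] A' ⊗[k] Γ(X.left, (W s).1 ⊓ (W t).1))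
    (hψW : (∀ (s t : κ) (Φ : A' ⊗[k] Γ(X.left, (U (τ s)).1 ⊓ (U (τ t)).1) →ₐ[A']
        A' ⊗[k] Γ(X.left, (W s).1 ⊓ (W t).1)),
      (∀ a' x, Φ (a' ⊗ₜ x) = a' ⊗ₜ X.left.presheaf.map (homOfLE (inf_le_inf (hτ s) (hτ t))).op x) →
      ∀ x, ψW s t (Φ x) = Φ (ψ (τ s) (τ t) x)))
    (hψW𝔫 : ∀ s t x, ψW s t x - x ∈ 𝔫' • (⊤ : Submodule A' (A' ⊗[k] Γ(X.left, (W s).1 ⊓ (W t).1))))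
    (ψ₂W : (s t : κ) → A' ⊗[k] Γ(X.left, (W s).1 ⊓ (W t).1) ≃ₐ[A'] A' ⊗[k] Γ(X.left, (W s).1 ⊓ (W t).1))
    (hψ₂W : (∀ (s t : κ) (Φ : A' ⊗[k] Γ(X.left, (U₂ (τ₂ s)).1 ⊓ (U₂ (τ₂ t)).1) →ₐ[A']
        A' ⊗[k] Γ(X.left, (W s).1 ⊓ (W t).1)),
      (∀ a' x, Φ (a' ⊗ₜ x) = a' ⊗ₜ X.left.presheaf.map (homOfLE (inf_le_inf (hτ₂ s) (hτ₂ t))).op x) →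
      ∀ x, ψ₂W s t (Φ x) = Φ (ψ₂ (τ₂ s) (τ₂ t) x)))
    (hψ₂W𝔫 : ∀ s t x, ψ₂W s t x - x ∈ 𝔫' • (⊤ : Submodule A' (A' ⊗[k] Γ(X.left, (W s).1 ⊓ (W t).1))))
    -- the change-of-atlas intertwiners on `𝔚` (★-to-be `SmoothSchemeLiftChartIntertwiners`; here hypotheses)
    (F : (s : κ) → A' ⊗[k] Γ(X.left, (W s).1) ≃ₐ[A'] A' ⊗[k] Γ(X.left, (W s).1))
    (hF : ∀ s x, F s x - x ∈ 𝔫' • (⊤ : Submodule A' (A' ⊗[k] Γ(X.left, (W s).1))))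
    (hFψ : (∀ (s t : κ)
      (Φs : A' ⊗[k] Γ(X.left, (W s).1) →ₐ[A'] A' ⊗[k] Γ(X.left, (W s).1 ⊓ (W t).1))
      (_ : ∀ a x, Φs (a ⊗ₜ x) = a ⊗ₜ X.left.presheaf.map (homOfLE inf_le_left).op x)
      (Φt : A' ⊗[k] Γ(X.left, (W t).1) →ₐ[A'] A' ⊗[k] Γ(X.left, (W s).1 ⊓ (W t).1))
      (_ : ∀ a x, Φt (a ⊗ₜ x) = a ⊗ₜ X.left.presheaf.map (homOfLE inf_le_right).op x)
      (Fs Ft : A' ⊗[k] Γ(X.left, (W s).1 ⊓ (W t).1) ≃ₐ[A'] A' ⊗[k] Γ(X.left, (W s).1 ⊓ (W t).1)),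
      (∀ x, Fs (Φs x) = Φs (F s x)) → (∀ x, Ft (Φt x) = Φt (F t x)) →
      ∀ c : Γ(X.left, (W s).1 ⊓ (W t).1),
        Ft (ψW s t ((1 : A') ⊗ₜ c)) - ψ₂W s t (Fs ((1 : A') ⊗ₜ c)) ∈
          J • (⊤ : Submodule A' (A' ⊗[k] Γ(X.left, (W s).1 ⊓ (W t).1))))) :
    cechMRefineC2 X.hom (tangentSheaf X) (fun j => (U₂ j).1) (fun s => (W s).1) τ₂ hτ₂ o₂ -
        cechMRefineC2 X.hom (tangentSheaf X) (fun j => (U j).1) (fun s => (W s).1) τ hτ o ∈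
      cechMB2 X.hom (tangentSheaf X) (fun s => (W s).1) := by
  obtain ⟨α, hα⟩ := exists_cechMD1_eq_refineC2_sub_refineC2 halg J 𝔫' hJ hJ𝔫 e U b hb U₂ b₂ hb₂ W c hc τ hτ a hWa
    τ₂ hτ₂ a₂ hWa₂ h𝔫 ψ hψ o ho ψ₂ hψ₂ o₂ ho₂ ψW hψW hψW𝔫 ψ₂W hψ₂W hψ₂W𝔫 F hF hFψ
  exact (mem_cechMB2_iff X.hom (tangentSheaf X) _ _).mpr ⟨α, hα.symm⟩

include halg hJ hJ𝔫 hb hb₂ hc hWa hWa₂ in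
/-- **COVER INDEPENDENCE OF THE OBSTRUCTION CLASS, componentwise** (relation rel₂ of the componentwise criterion
`Morphisms/CechModuleH2ScalingVanishing`): for every morphism `φ : 𝒯_{X/k} ⟶ N` (e.g. a frame projection
`π_a : 𝒯 ⟶ 𝒪`), `[ρ_{τ₂}(φ o₂)] = [ρ_τ(φ o)]` in `Ȟ²(𝔚, N)` (`o`, `o₂` cocycles).
[cite: Hartshorne2010, Thm. 10.2 (proof), p. 81] [cite: GortzWedhorn2023, (21.16) Lemma 21.72] -/
theorem CechMH2.mk_refineC2_mapC2_eq_of_two_covers (h𝔫 : IsNilpotent 𝔫')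
    -- cover 1: lifted transition automorphisms `ψ` and an obstruction cochain `o` of them (★ F2's characterisation)
    (ψ : (j l : ι) → A' ⊗[k] Γ(X.left, (U j).1 ⊓ (U l).1) ≃ₐ[A'] A' ⊗[k] Γ(X.left, (U j).1 ⊓ (U l).1))
    (hψ : ∀ j l x, ψ j l x - x ∈ 𝔫' • (⊤ : Submodule A' (A' ⊗[k] Γ(X.left, (U j).1 ⊓ (U l).1))))
    (o : CechMC2 X.hom (tangentSheaf X) (fun j => (U j).1))
    (ho : (∀ (j l m : ι)
      (Φjl : A' ⊗[k] Γ(X.left, (U j).1 ⊓ (U l).1) →ₐ[A'] A' ⊗[k] Γ(X.left, (U j).1 ⊓ (U l).1 ⊓ (U m).1))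
      (_ : ∀ a s, Φjl (a ⊗ₜ s) = a ⊗ₜ X.left.presheaf.map (homOfLE inf_le_left).op s)
      (Φlm : A' ⊗[k] Γ(X.left, (U l).1 ⊓ (U m).1) →ₐ[A'] A' ⊗[k] Γ(X.left, (U j).1 ⊓ (U l).1 ⊓ (U m).1))
      (_ : ∀ a s, Φlm (a ⊗ₜ s) = a ⊗ₜ X.left.presheaf.map
        (homOfLE (le_inf (inf_le_left.trans inf_le_right) inf_le_right)).op s)
      (Φjm : A' ⊗[k] Γ(X.left, (U j).1 ⊓ (U m).1) →ₐ[A'] A' ⊗[k] Γ(X.left, (U j).1 ⊓ (U l).1 ⊓ (U m).1))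
      (_ : ∀ a s, Φjm (a ⊗ₜ s) = a ⊗ₜ X.left.presheaf.map
        (homOfLE (le_inf (inf_le_left.trans inf_le_left) inf_le_right)).op s)
      (ρjl ρlm ρjm : A' ⊗[k] Γ(X.left, (U j).1 ⊓ (U l).1 ⊓ (U m).1) ≃ₐ[A']
        A' ⊗[k] Γ(X.left, (U j).1 ⊓ (U l).1 ⊓ (U m).1)),
      (∀ x, ρjl (Φjl x) = Φjl (ψ j l x)) → (∀ x, ρlm (Φlm x) = Φlm (ψ l m x)) →
      (∀ x, ρjm (Φjm x) = Φjm (ψ j m x)) →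
      ∀ c : Γ(X.left, (U j).1 ⊓ (U l).1 ⊓ (U m).1), (ρlm * ρjl * ρjm⁻¹) ((1 : A') ⊗ₜ c) =
        (1 : A') ⊗ₜ c + ((e.symm 1 : ↥(J.restrictScalars k)) : A') ⊗ₜ
          (show Γ(X.left, (U j).1 ⊓ (U l).1 ⊓ (U m).1) from appLE (o j l m) (𝟙 _) (dSection X _ c))))
    -- cover 2: likewise
    (ψ₂ : (j l : ι₂) → A' ⊗[k] Γ(X.left, (U₂ j).1 ⊓ (U₂ l).1) ≃ₐ[A'] A' ⊗[k] Γ(X.left, (U₂ j).1 ⊓ (U₂ l).1))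
    (hψ₂ : ∀ j l x, ψ₂ j l x - x ∈ 𝔫' • (⊤ : Submodule A' (A' ⊗[k] Γ(X.left, (U₂ j).1 ⊓ (U₂ l).1))))
    (o₂ : CechMC2 X.hom (tangentSheaf X) (fun j => (U₂ j).1))
    (ho₂ : (∀ (j l m : ι₂)
      (Φjl : A' ⊗[k] Γ(X.left, (U₂ j).1 ⊓ (U₂ l).1) →ₐ[A'] A' ⊗[k] Γ(X.left, (U₂ j).1 ⊓ (U₂ l).1 ⊓ (U₂ m).1))
      (_ : ∀ a s, Φjl (a ⊗ₜ s) = a ⊗ₜ X.left.presheaf.map (homOfLE inf_le_left).op s)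
      (Φlm : A' ⊗[k] Γ(X.left, (U₂ l).1 ⊓ (U₂ m).1) →ₐ[A'] A' ⊗[k] Γ(X.left, (U₂ j).1 ⊓ (U₂ l).1 ⊓ (U₂ m).1))
      (_ : ∀ a s, Φlm (a ⊗ₜ s) = a ⊗ₜ X.left.presheaf.map
        (homOfLE (le_inf (inf_le_left.trans inf_le_right) inf_le_right)).op s)
      (Φjm : A' ⊗[k] Γ(X.left, (U₂ j).1 ⊓ (U₂ m).1) →ₐ[A'] A' ⊗[k] Γ(X.left, (U₂ j).1 ⊓ (U₂ l).1 ⊓ (U₂ m).1))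
      (_ : ∀ a s, Φjm (a ⊗ₜ s) = a ⊗ₜ X.left.presheaf.map
        (homOfLE (le_inf (inf_le_left.trans inf_le_left) inf_le_right)).op s)
      (ρjl ρlm ρjm : A' ⊗[k] Γ(X.left, (U₂ j).1 ⊓ (U₂ l).1 ⊓ (U₂ m).1) ≃ₐ[A']
        A' ⊗[k] Γ(X.left, (U₂ j).1 ⊓ (U₂ l).1 ⊓ (U₂ m).1)),
      (∀ x, ρjl (Φjl x) = Φjl (ψ₂ j l x)) → (∀ x, ρlm (Φlm x) = Φlm (ψ₂ l m x)) →
      (∀ x, ρjm (Φjm x) = Φjm (ψ₂ j m x)) →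
      ∀ c : Γ(X.left, (U₂ j).1 ⊓ (U₂ l).1 ⊓ (U₂ m).1), (ρlm * ρjl * ρjm⁻¹) ((1 : A') ⊗ₜ c) =
        (1 : A') ⊗ₜ c + ((e.symm 1 : ↥(J.restrictScalars k)) : A') ⊗ₜ
          (show Γ(X.left, (U₂ j).1 ⊓ (U₂ l).1 ⊓ (U₂ m).1) from appLE (o₂ j l m) (𝟙 _) (dSection X _ c))))
    -- the restricted lift systems on the common refinement `𝔚` (★ `exists_algEquiv_refine` outputs, both clauses)
    (ψW : (s t : κ) → A' ⊗[k] Γ(X.left, (W s).1 ⊓ (W t).1) ≃ₐ[A'] A' ⊗[k] Γ(X.left, (W s).1 ⊓ (W t).1))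
    (hψW : (∀ (s t : κ) (Φ : A' ⊗[k] Γ(X.left, (U (τ s)).1 ⊓ (U (τ t)).1) →ₐ[A']
        A' ⊗[k] Γ(X.left, (W s).1 ⊓ (W t).1)),
      (∀ a' x, Φ (a' ⊗ₜ x) = a' ⊗ₜ X.left.presheaf.map (homOfLE (inf_le_inf (hτ s) (hτ t))).op x) →
      ∀ x, ψW s t (Φ x) = Φ (ψ (τ s) (τ t) x)))
    (hψW𝔫 : ∀ s t x, ψW s t x - x ∈ 𝔫' • (⊤ : Submodule A' (A' ⊗[k] Γ(X.left, (W s).1 ⊓ (W t).1))))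
    (ψ₂W : (s t : κ) → A' ⊗[k] Γ(X.left, (W s).1 ⊓ (W t).1) ≃ₐ[A'] A' ⊗[k] Γ(X.left, (W s).1 ⊓ (W t).1))
    (hψ₂W : (∀ (s t : κ) (Φ : A' ⊗[k] Γ(X.left, (U₂ (τ₂ s)).1 ⊓ (U₂ (τ₂ t)).1) →ₐ[A']
        A' ⊗[k] Γ(X.left, (W s).1 ⊓ (W t).1)),
      (∀ a' x, Φ (a' ⊗ₜ x) = a' ⊗ₜ X.left.presheaf.map (homOfLE (inf_le_inf (hτ₂ s) (hτ₂ t))).op x) →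
      ∀ x, ψ₂W s t (Φ x) = Φ (ψ₂ (τ₂ s) (τ₂ t) x)))
    (hψ₂W𝔫 : ∀ s t x, ψ₂W s t x - x ∈ 𝔫' • (⊤ : Submodule A' (A' ⊗[k] Γ(X.left, (W s).1 ⊓ (W t).1))))
    -- the change-of-atlas intertwiners on `𝔚` (★-to-be `SmoothSchemeLiftChartIntertwiners`; here hypotheses)
    (F : (s : κ) → A' ⊗[k] Γ(X.left, (W s).1) ≃ₐ[A'] A' ⊗[k] Γ(X.left, (W s).1))
    (hF : ∀ s x, F s x - x ∈ 𝔫' • (⊤ : Submodule A' (A' ⊗[k] Γ(X.left, (W s).1))))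
    (hFψ : (∀ (s t : κ)
      (Φs : A' ⊗[k] Γ(X.left, (W s).1) →ₐ[A'] A' ⊗[k] Γ(X.left, (W s).1 ⊓ (W t).1))
      (_ : ∀ a x, Φs (a ⊗ₜ x) = a ⊗ₜ X.left.presheaf.map (homOfLE inf_le_left).op x)
      (Φt : A' ⊗[k] Γ(X.left, (W t).1) →ₐ[A'] A' ⊗[k] Γ(X.left, (W s).1 ⊓ (W t).1))
      (_ : ∀ a x, Φt (a ⊗ₜ x) = a ⊗ₜ X.left.presheaf.map (homOfLE inf_le_right).op x)
      (Fs Ft : A' ⊗[k] Γ(X.left, (W s).1 ⊓ (W t).1) ≃ₐ[A'] A' ⊗[k] Γ(X.left, (W s).1 ⊓ (W t).1)),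
      (∀ x, Fs (Φs x) = Φs (F s x)) → (∀ x, Ft (Φt x) = Φt (F t x)) →
      ∀ c : Γ(X.left, (W s).1 ⊓ (W t).1),
        Ft (ψW s t ((1 : A') ⊗ₜ c)) - ψ₂W s t (Fs ((1 : A') ⊗ₜ c)) ∈
          J • (⊤ : Submodule A' (A' ⊗[k] Γ(X.left, (W s).1 ⊓ (W t).1)))))
    (hoZ : o ∈ cechMZ2 X.hom (tangentSheaf X) (fun j => (U j).1))
    (ho₂Z : o₂ ∈ cechMZ2 X.hom (tangentSheaf X) (fun j => (U₂ j).1))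
    {N : X.left.Modules} (φ : tangentSheaf X ⟶ N) :
    CechMH2.mk X.hom N (fun s => (W s).1)
        ⟨cechMRefineC2 X.hom N (fun j => (U₂ j).1) (fun s => (W s).1) τ₂ hτ₂ (cechMapC2 X.hom φ (fun j => (U₂ j).1) o₂),
          refineMC2_mem_cechMZ2 X.hom N (fun j => (U₂ j).1) (fun s => (W s).1) τ₂ hτ₂
            (mapC2_mem_cechMZ2 X.hom φ (fun j => (U₂ j).1) ho₂Z)⟩ =
      CechMH2.mk X.hom N (fun s => (W s).1)
        ⟨cechMRefineC2 X.hom N (fun j => (U j).1) (fun s => (W s).1) τ hτ (cechMapC2 X.hom φ (fun j => (U j).1) o),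
          refineMC2_mem_cechMZ2 X.hom N (fun j => (U j).1) (fun s => (W s).1) τ hτ
            (mapC2_mem_cechMZ2 X.hom φ (fun j => (U j).1) hoZ)⟩ :=
  CechMH2.mk_refineC2_mapC2_eq_of_refineC2_sub_refineC2_mem_cechMB2 X.hom φ (fun j => (U j).1) (fun s => (W s).1)
    τ hτ (fun j => (U₂ j).1) τ₂ hτ₂ hoZ ho₂Z
    (refineC2_sub_refineC2_mem_cechMB2 halg J 𝔫' hJ hJ𝔫 e U b hb U₂ b₂ hb₂ W c hc τ hτ a hWa τ₂ hτ₂ a₂ hWa₂ h𝔫 ψ hψ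
      o ho ψ₂ hψ₂ o₂ ho₂ ψW hψW hψW𝔫 ψ₂W hψ₂W hψ₂W𝔫 F hF hFψ)

end Literature.AlgebraicGeometry.Deformation

end
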